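import Literature.MeasureTheory.Group.InvariantQuotientProd
import HarnessLib

/-!
# Products of (cocompact, discrete, countable) subgroups

Topic `Topology/Algebra`; namespace `Literature.Topology.Algebra` (sub-namespaces `Subgroup`, `QuotientGroup` after the
objects).  The generic facts that transport lattice-type hypotheses from two pairs `(G, H)`, `(N, K)` of a topological
group and a subgroup to the product pair `(G × N, H.prod K)`:

* `Subgroup.countable_prod` : `Countable H → Countable K → Countable (H.prod K)`;
* `Subgroup.discreteTopology_prod` : `DiscreteTopology H → DiscreteTopology K → DiscreteTopology (H.prod K)`;
* `QuotientGroup.compactSpace_quotient_prod` : `CompactSpace (G ⧸ H) → CompactSpace (N ⧸ K) → CompactSpace ((G × N) ⧸ H.prod K)`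
  — **a product of cocompact subgroups is cocompact** — through the tree's homeomorphism
  `Literature.MeasureTheory.Group.quotientProdHomeomorph : (G × N) ⧸ H.prod K ≃ₜ (G ⧸ H) × (N ⧸ K)`
  (`InvariantQuotientProd.lean`, Mathlib's `QuotientGroup.prodEquiv` made bicontinuous);
* `QuotientGroup.quotientProdContinuousMulEquiv` : for NORMAL subgroups the same map is an isomorphism of topological
  groups `(G × N) ⧸ H.prod K ≃ₜ* (G ⧸ H) × (N ⧸ K)` (e.g. `[T₁ × T₂] ≃ₜ* [T₁] × [T₂]` for adelic quotients of a product
  of commutative groups).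

Stated as theorems / definitions (no global instances), to be invoked with `haveI`.  Typical use: `T = A × A`,
`Λ = Λ₀.prod Λ₀` with `Λ₀ ≤ A` discrete, countable and cocompact — then so is `Λ ≤ T` [folklore]; Mathlib + the tree only.

## Provenance

Reproduced for the tree under the LEAN-IN-TREE rule (2026-08-18) from §1 of the pub-hodgecm cell's package file
`HodgeCM/PerL34/ProductLattice.lean` (DAG-node prover #06 lineage, seat pv06 generation 3, gate run 26; 203 lines), whose
own `quotientProdMap` / `quotientProdInv` / `quotientProdHomeomorph` are REPLACED by the tree's `quotientProdHomeomorph`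
(so only the residue is reproduced; its §2 consisted of `example`s and is omitted); nothing cited as a hypothesis,
nothing posited.
-/

set_option autoImplicit false

namespace Literature.Topology.Algebra

namespace Subgroup

variable {G N : Type*} [Group G] [Group N]

/-- A product of countable subgroups is countable. [folklore] -/
theorem countable_prod (H : _root_.Subgroup G) (K : _root_.Subgroup N) [Countable H] [Countable K] :
    Countable (H.prod K) :=
  Countable.of_equiv (H × K) (H.prodEquiv K).toEquiv.symm

variable [TopologicalSpace G] [TopologicalSpace N]

/-- A product of discrete subgroups is discrete. [folklore] -/
theorem discreteTopology_prod (H : _root_.Subgroup G) (K : _root_.Subgroup N) [DiscreteTopology H]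
    [DiscreteTopology K] : DiscreteTopology (H.prod K) :=
  DiscreteTopology.of_continuous_injective
    (f := fun x : H.prod K =>
      ((⟨x.1.1, (_root_.Subgroup.mem_prod.mp x.2).1⟩ : H), (⟨x.1.2, (_root_.Subgroup.mem_prod.mp x.2).2⟩ : K)))
    (((continuous_fst.comp continuous_subtype_val).subtype_mk _).prodMk
      ((continuous_snd.comp continuous_subtype_val).subtype_mk _))
    (fun x y hxy => by
      simp only [Prod.mk.injEq, Subtype.mk.injEq] at hxy
      exact Subtype.ext (Prod.ext hxy.1 hxy.2))

end Subgroup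

namespace QuotientGroup

open Literature.MeasureTheory.Group

variable {G N : Type*} [Group G] [Group N] [TopologicalSpace G] [TopologicalSpace N]
  [ContinuousMul G] [ContinuousMul N] (H : _root_.Subgroup G) (K : _root_.Subgroup N)

/-- **A product of cocompact subgroups is cocompact**: `(G × N) ⧸ (H × K)` is compact if `G ⧸ H` and `N ⧸ K`
are. [folklore] -/
theorem compactSpace_quotient_prod [CompactSpace (G ⧸ H)] [CompactSpace (N ⧸ K)] :
    CompactSpace ((G × N) ⧸ H.prod K) :=
  (quotientProdHomeomorph H K).symm.compactSpace

/-- `quotientProdHomeomorph` on classes: `(g, n)(H × K) ↦ (gH, nK)`. [folklore] -/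
@[simp]
theorem quotientProdHomeomorph_mk (g : G) (n : N) :
    quotientProdHomeomorph H K (QuotientGroup.mk (g, n)) = ((g : G ⧸ H), (n : N ⧸ K)) := rfl

section Normal

variable [H.Normal] [K.Normal]

/-- For normal subgroups, `(G × N) ⧸ (H × K) ≃ₜ* (G ⧸ H) × (N ⧸ K)` as topological groups. [folklore] -/
noncomputable def quotientProdContinuousMulEquiv : (G × N) ⧸ H.prod K ≃ₜ* (G ⧸ H) × (N ⧸ K) :=
  { quotientProdHomeomorph H K with
    map_mul' := by
      intro x y
      induction x using QuotientGroup.induction_on with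
      | H p =>
        induction y using QuotientGroup.induction_on with
        | H q =>
          obtain ⟨g₁, n₁⟩ := p
          obtain ⟨g₂, n₂⟩ := q
          rfl }

/-- `quotientProdContinuousMulEquiv` on classes. [folklore] -/
@[simp]
theorem quotientProdContinuousMulEquiv_mk (g : G) (n : N) :
    quotientProdContinuousMulEquiv H K (QuotientGroup.mk (g, n)) = ((g : G ⧸ H), (n : N ⧸ K)) := rfl

/-- The underlying homeomorphism of `quotientProdContinuousMulEquiv` is `quotientProdHomeomorph`. [folklore] -/
theorem toHomeomorph_quotientProdContinuousMulEquiv :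
    (quotientProdContinuousMulEquiv H K).toHomeomorph = quotientProdHomeomorph H K := rfl

end Normal

end QuotientGroup

end Literature.Topology.Algebra
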